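import Summits.CriticalPhenomena.SAWScalingLimit.Theorems.SAWDevelopingMapInteriorFlatteningOneMouthDefs
import Literature.Probability.RandomPlanarGeometry.HexParafermionSpinShift

/-!
# One-scale glue of the line `one-mouth-ball-reduction` (crux `InteriorFlattening`, stmt-CriticalPhenomena-8297)

Lead prover `prover-line-stmt-CriticalPhenomena-8297-0`. Elementary lemmas used by the line's composition theorem
(`Theorems/SAWDevelopingMapInteriorFlatteningOneScale.lean`): `norm_omega`, the crude bound `‖B_D(v)‖ ≤ pmass_D(v)`
(`norm_bel_le_pmass`), vanishing of the observable of a rootless inner domain (`Fobs_eq_zero_of_not_mem`),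
`dist_le_one_of_adj`, antitonicity of `Deep` (`deep_anti`), `exists_not_deep`, and the
DYADIC WINDOW `exists_window` (registered sub-goal): if `v` is `2r₀`-deep there is an adaptive radius `r ≥ r₀` with
`B(v,2r) ⊆ Λ` but `B(v,4r) ⊄ Λ` — the device that lets the one-scale estimate use the WINDOWED far-field coherence
and arm gap (reshape r2 of the line, after the wave-1 kill of the unwindowed S3). All [folklore]-level.
-/

noncomputable section

open scoped BigOperators
open Literature.Probability.LatticeModels Literature.Probability.RandomPlanarGeometry.SAW

namespace Summit.CriticalPhenomena.SAWScalingLimit.Theorems.InteriorFlattening.OneMouth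

/-- `‖ω‖ = 1`. -/
theorem norm_omega : ‖omega‖ = 1 := by
  have h : (2 * (Real.pi : ℂ) * Complex.I / 3) = ((2 * Real.pi / 3 : ℝ) : ℂ) * Complex.I := by
    push_cast; ring
  rw [omega, h, Complex.norm_exp_ofReal_mul_I]

/-- The crude bound `‖B_D(v)‖ ≤ pmass_D(v)` (triangle inequality, `‖ω‖ = 1`). -/
theorem norm_bel_le_pmass (Λ : Finset HexVertex) (a : Sym2 HexVertex) (v w₀ w₁ w₂ : HexVertex) :
    ‖bel Λ a v w₀ w₁ w₂‖ ≤ pmass Λ a v w₀ w₁ w₂ := by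
  unfold bel pmass
  have h0 := norm_Fobs_le_zmass Λ a s(v, w₀)
  have h1 := norm_Fobs_le_zmass Λ a s(v, w₁)
  have h2 := norm_Fobs_le_zmass Λ a s(v, w₂)
  calc ‖Fobs Λ a s(v, w₀) + omega * Fobs Λ a s(v, w₁) + omega ^ 2 * Fobs Λ a s(v, w₂)‖
      ≤ ‖Fobs Λ a s(v, w₀)‖ + ‖omega * Fobs Λ a s(v, w₁)‖ + ‖omega ^ 2 * Fobs Λ a s(v, w₂)‖ :=
        norm_add₃_le
    _ = ‖Fobs Λ a s(v, w₀)‖ + ‖Fobs Λ a s(v, w₁)‖ + ‖Fobs Λ a s(v, w₂)‖ := by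
        rw [norm_mul, norm_mul, norm_pow, norm_omega]; ring
    _ ≤ _ := by linarith

/-- If the root `{u, u'}` has no endpoint in `D`, the observable of `D` vanishes identically. -/
theorem Fobs_eq_zero_of_not_mem {D : Finset HexVertex} {u u' : HexVertex} (hu : u ∉ D)
    (hu' : u' ∉ D) (z : Sym2 HexVertex) : Fobs D s(u, u') z = 0 := by
  refine hexParafermionicObservable_eq_zero_of_not_mem ?_ _ _ _
  rintro ⟨-, t, ht, htD⟩
  rcases Sym2.mem_iff.1 ht with rfl | rfl
  · exact hu htD
  · exact hu' htD

/-- Adjacent honeycomb vertices are at distance `≤ 1` (the distance is `1/√3`). -/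
theorem dist_le_one_of_adj {v t : HexVertex} (h : hexGraph.Adj v t) :
    dist (hexCenter t) (hexCenter v) ≤ 1 := by
  rw [dist_eq_norm, norm_hexCenter_sub_of_adj h]
  rw [inv_le_one_iff₀]
  exact Or.inr (Real.one_le_sqrt.2 (by norm_num))

/-- `Deep` is antitone in the radius. -/
theorem deep_anti {Λ : Finset HexVertex} {v : HexVertex} {R R' : ℝ} (h : Deep Λ v R) (hle : R' ≤ R) :
    Deep Λ v R' := fun w hw => h w (hw.trans hle)

/-- A finite domain is not deep at every scale: some lattice vertex lies outside `Λ`. -/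
theorem exists_not_deep (Λ : Finset HexVertex) (v : HexVertex) : ∃ R : ℝ, ¬ Deep Λ v R := by
  haveI : Infinite (Site 2) := Pi.infinite_of_right
  obtain ⟨w, hw⟩ := Infinite.exists_notMem_finset Λ
  exact ⟨dist (hexCenter w) (hexCenter v), fun h => hw (h w le_rfl)⟩

/-- **Dyadic window** (registered sub-goal). If `v` is `2r₀`-deep (`r₀ > 0`) there is an adaptive radius `r ≥ r₀`
at which `v` is `2r`-deep but NOT `4r`-deep (`r = 2^k r₀` for the last good `k`; `k` is bounded because `Λ` is
finite). -/
theorem exists_window :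
    ∀ (Λ : Finset HexVertex) (v : HexVertex) (r₀ : ℝ), 0 < r₀ → Deep Λ v (2 * r₀) →
      ∃ r : ℝ, r₀ ≤ r ∧ Deep Λ v (2 * r) ∧ ¬ Deep Λ v (4 * r) := by
  intro Λ v r₀ h₀ h
  by_contra hcon
  push Not at hcon
  have hall : ∀ k : ℕ, Deep Λ v (2 * (2 ^ k * r₀)) := by
    intro k
    induction k with
    | zero => simpa using h
    | succ k ih =>
      have hk : r₀ ≤ 2 ^ k * r₀ := le_mul_of_one_le_left h₀.le (one_le_pow₀ (by norm_num))
      have := hcon (2 ^ k * r₀) hk ih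
      have e : (4 : ℝ) * (2 ^ k * r₀) = 2 * (2 ^ (k + 1) * r₀) := by ring
      rwa [e] at this
  obtain ⟨R, hR⟩ := exists_not_deep Λ v
  obtain ⟨k, hk⟩ := pow_unbounded_of_one_lt (R / (2 * r₀)) (by norm_num : (1 : ℝ) < 2)
  have hle : R ≤ 2 * (2 ^ k * r₀) := by
    have h2 : 0 < 2 * r₀ := by positivity
    have := (div_lt_iff₀ h2).1 hk
    nlinarith
  exact hR (deep_anti (hall k) hle)

end Summit.CriticalPhenomena.SAWScalingLimit.Theorems.InteriorFlattening.OneMouth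

end
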